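import Summits.ABC.IUTFork.Cor312PilotKummerSplitShells
import HarnessLib

/-!
# [IUTchIII] Cor. 3.12 — the SPLIT natural model P♮₁ of the residual `S`, II: boxes, frame, volume, data, setting, operator

Record-only file (D-0012; MODEL DATA, no `Prop` fact) of the abc-iut cell (wave 5, seat abc-iut-w5-d230 gen 4; by-name support piece for
the IUT REPAIR branch), sequel of `Cor312PilotKummerSplitShells` (split index, coordinates `coord c`, capsule-permutation action). TAKES NO
SIDE on [IUTchIII] Cor. 3.12. CONTENTS: §2 the boxes `boxLE b D` / hull-sets `box D` (deep exactly on `D`), their transport under capsule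
permutations (`image_boxLE_of_perm`: `σ·box D = box (permD σ D)`), the deep set of a region, the hull frame `splitFrame` (hull of a bounded
region = box of its deep set, `splitFrame_hull`) and the log-volume `splitVol = −1 − #deepSet`; §3 the Θ-point `thetaPt` (theta value in
the LAST tensor factor, supported on the bad summand — [IUTchIII] Prop. 3.4 (ii) sub-packet) and its deep set `DTheta j = {c | c(j) = false}`;
§4 data / column (identity Kummer transport) / full situation (link = abc-iut-w5-d247's `naiveLink`); §5 the setting `splitSetting` with honest
pilot objects (`splitSig`, abc-iut-w4-d101's `ExpMonoid`) and glue reading the exponent; §6 the region operator `boxRegion` (box generated by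
the datum's component — coordinatewise, hence (Ind1)-equivariant) and the q-datum `qDatumSplit := swapFamily · Ψ`. Proofs in the sequels.
Interface-level toy; [claim: Mochizuki2012, status: disputed] for every IUT noun.
-/

noncomputable section

open Set

namespace Summit.ABC.IUTFork.Cor312Vol

namespace SplitWitness

open Thm311 Cor312 Cor312.IdentifiedNonVacuity NaiveWitness PinnedWitness Literature.IUT.LogThetaLattice

/-! ## 2. Boxes, the hull frame, the log-volume -/

/-- The BOX with deep coordinates `D` and depth bound `b`: `|coord c| ≤ 8` for every `c`, `|coord c| ≤ b` for `c ∈ D` (the hull-sets are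
the boxes with `b = 1`; the glue reads the exponent through `b`). [folklore] -/
def boxLE {j : splitIndex.Label} {vQ : splitIndex.VQ} (b : ℚ) (D : Finset (splitIndex.Caps j → Bool)) :
    Set (splitShells.Packet j vQ) :=
  {x | (∀ c, |coord j vQ c x| ≤ 8) ∧ ∀ c ∈ D, |coord j vQ c x| ≤ b}

/-- The HULL-SETS of P♮₁: the boxes `box D := boxLE 1 D` («`λ·𝒪` with `λ` deep exactly on the coordinates in `D`»). [folklore] -/
def box {j : splitIndex.Label} {vQ : splitIndex.VQ} (D : Finset (splitIndex.Caps j → Bool)) : Set (splitShells.Packet j vQ) :=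
  boxLE 1 D

/-- `0` lies in every box. [folklore] -/
theorem zero_mem_boxLE {j : splitIndex.Label} {vQ : splitIndex.VQ} {b : ℚ} (hb : 0 ≤ b) (D : Finset (splitIndex.Caps j → Bool)) :
    (0 : splitShells.Packet j vQ) ∈ boxLE b D :=
  ⟨fun c => by rw [map_zero, abs_zero]; norm_num, fun c _ => by rw [map_zero, abs_zero]; exact hb⟩

/-- More deep coordinates, smaller box. [folklore] -/
theorem box_antitone {j : splitIndex.Label} {vQ : splitIndex.VQ} {D D' : Finset (splitIndex.Caps j → Bool)} (h : D ⊆ D') :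
    (box D' : Set (splitShells.Packet j vQ)) ⊆ box D :=
  fun _ hx => ⟨hx.1, fun c hc => hx.2 c (h hc)⟩

/-- `U ⊆ box D` iff `U` is bounded (`⊆ box ∅`) and deep on every coordinate of `D`. [folklore] -/
theorem subset_box_iff {j : splitIndex.Label} {vQ : splitIndex.VQ} (U : Set (splitShells.Packet j vQ))
    (D : Finset (splitIndex.Caps j → Bool)) : U ⊆ box D ↔ U ⊆ box ∅ ∧ ∀ c ∈ D, U ⊆ box {c} := by
  constructor
  · intro h
    exact ⟨h.trans (box_antitone (Finset.empty_subset D)), fun c hc => h.trans (box_antitone (Finset.singleton_subset_iff.2 hc))⟩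
  · rintro ⟨h0, h1⟩ x hx
    exact ⟨(h0 hx).1, fun c hc => (h1 c hc hx).2 c (Finset.mem_singleton_self c)⟩

/-- The permutation `σ` transports a set of deep coordinates by `c ↦ c ∘ σ⁻¹`. [folklore] -/
def permD {j : splitIndex.Label} (σ : Equiv.Perm (splitIndex.Caps j)) (D : Finset (splitIndex.Caps j → Bool)) :
    Finset (splitIndex.Caps j → Bool) :=
  D.image fun c => c ∘ ⇑σ.symm

/-- Membership in the transported set: `c ∈ permD σ D ↔ c ∘ σ ∈ D`. [folklore] -/
theorem mem_permD_iff {j : splitIndex.Label} (σ : Equiv.Perm (splitIndex.Caps j)) (D : Finset (splitIndex.Caps j → Bool))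
    (c : splitIndex.Caps j → Bool) : c ∈ permD σ D ↔ c ∘ ⇑σ ∈ D := by
  unfold permD
  rw [Finset.mem_image]
  constructor
  · rintro ⟨c', hc', rfl⟩
    have : (c' ∘ ⇑σ.symm) ∘ ⇑σ = c' := funext fun i => by simp
    rw [this]; exact hc'
  · intro h
    exact ⟨c ∘ ⇑σ, h, funext fun i => by simp⟩

/-- **A family acting by the permutation `σ` carries `boxLE b D` onto `boxLE b (permD σ D)`** — boxes go to boxes, deep sets are
transported. [folklore] -/
theorem image_boxLE_of_perm {Φ : splitShells.PacketAut} {j : splitIndex.Label} {vQ : splitIndex.VQ}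
    {σ : Equiv.Perm (splitIndex.Caps j)} (hΦ : ∀ x, Φ j vQ x = splitShells.permute j vQ σ x) (b : ℚ)
    (D : Finset (splitIndex.Caps j → Bool)) : Φ j vQ '' boxLE b D = boxLE b (permD σ D) := by
  have hsymm : ∀ y, (Φ j vQ).symm y = splitShells.permute j vQ σ.symm y := fun y => by
    rw [show Φ j vQ = splitShells.permute j vQ σ from LinearEquiv.ext hΦ]
    show (PiTensorProduct.reindex ℚ (fun _ : splitIndex.Caps j => splitShells.Packet1 vQ) σ).symm y = _
    rw [PiTensorProduct.reindex_symm]; rfl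
  ext y
  constructor
  · rintro ⟨x, hx, rfl⟩
    rw [hΦ]
    refine ⟨fun c => ?_, fun c hc => ?_⟩
    · rw [coord_permute]; exact hx.1 _
    · rw [coord_permute]; exact hx.2 _ ((mem_permD_iff σ D c).1 hc)
  · rintro ⟨h8, hD⟩
    refine ⟨(Φ j vQ).symm y, ⟨fun c => ?_, fun c hc => ?_⟩, LinearEquiv.apply_symm_apply _ _⟩
    · rw [hsymm, coord_permute]; exact h8 _
    · rw [hsymm, coord_permute]
      apply hD
      rw [mem_permD_iff]
      have : (c ∘ ⇑σ.symm) ∘ ⇑σ = c := funext fun i => by simp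
      rw [this]; exact hc

open scoped Classical in
/-- The DEEP SET of a region: the coordinates on which it is deep (`U ⊆ box {c}`). [folklore] -/
def deepSet {j : splitIndex.Label} {vQ : splitIndex.VQ} (U : Set (splitShells.Packet j vQ)) : Finset (splitIndex.Caps j → Bool) :=
  Finset.univ.filter fun c => U ⊆ box {c}

/-- Membership in the deep set. [folklore] -/
theorem mem_deepSet_iff {j : splitIndex.Label} {vQ : splitIndex.VQ} (U : Set (splitShells.Packet j vQ)) (c : splitIndex.Caps j → Bool) :
    c ∈ deepSet U ↔ U ⊆ box {c} := by
  classical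
  unfold deepSet; simp only [Finset.mem_filter, Finset.mem_univ, true_and]

/-- A bounded region lies in the box of its deep set … [folklore] -/
theorem subset_box_deepSet {j : splitIndex.Label} {vQ : splitIndex.VQ} {U : Set (splitShells.Packet j vQ)} (hU : U ⊆ box ∅) :
    U ⊆ box (deepSet U) :=
  (subset_box_iff U _).2 ⟨hU, fun c hc => (mem_deepSet_iff U c).1 hc⟩

/-- … which is the LEAST box containing it. [folklore] -/
theorem box_deepSet_subset {j : splitIndex.Label} {vQ : splitIndex.VQ} {U : Set (splitShells.Packet j vQ)}
    {D : Finset (splitIndex.Caps j → Bool)} (h : U ⊆ box D) : (box (deepSet U) : Set (splitShells.Packet j vQ)) ⊆ box D :=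
  box_antitone fun c hc => (mem_deepSet_iff U c).2 (((subset_box_iff U D).1 h).2 c hc)

/-- The set of hull-sets: all boxes. [folklore] -/
def splitHul (j : splitIndex.Label) (vQ : splitIndex.VQ) : Set (Set (splitShells.Packet j vQ)) := {B | ∃ D, B = box D}

/-- **The HULL FRAME of P♮₁** on a packet: hull-sets the boxes, relatively compact = inside the shallow box `box ∅`, every bounded region
admits its hull = the box of its deep set (`∩`-closedness of the boxes). [folklore] -/
def splitFrame (j : splitIndex.Label) (vQ : splitIndex.VQ) : HullFrame (splitShells.Packet j vQ) where
  Hul := splitHul j vQ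
  IsBounded := fun U => U ⊆ box ∅
  HasHull := fun _ => True
  hul_bounded := fun _ hH => by obtain ⟨D, rfl⟩ := hH; exact box_antitone (Finset.empty_subset D)
  bounded_mono := fun _ _ h h' => h.trans h'
  exists_hul := fun U hU => ⟨box ∅, ⟨∅, rfl⟩, hU⟩
  hull_mem := fun U hU _ => by
    rw [sInter_eq_of_least (S := {H | H ∈ splitHul j vQ ∧ U ⊆ H}) (H₀ := box (deepSet U)) ⟨⟨_, rfl⟩, subset_box_deepSet hU⟩
      fun H hH => by obtain ⟨⟨D, rfl⟩, hUH⟩ := hH; exact box_deepSet_subset hUH]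
    exact ⟨_, rfl⟩

/-- In the split frame the holomorphic hull of a bounded region is the box of its deep set. [folklore] -/
theorem splitFrame_hull {j : splitIndex.Label} {vQ : splitIndex.VQ} {U : Set (splitShells.Packet j vQ)} (hU : U ⊆ box ∅) :
    (splitFrame j vQ).hull U = box (deepSet U) := by
  unfold HullFrame.hull
  rw [if_pos (show (splitFrame j vQ).IsBounded U from hU)]
  exact sInter_eq_of_least (S := {H | H ∈ splitHul j vQ ∧ U ⊆ H}) ⟨⟨_, rfl⟩, subset_box_deepSet hU⟩
    fun H hH => by obtain ⟨⟨D, rfl⟩, hUH⟩ := hH; exact box_deepSet_subset hUH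

open scoped Classical in
/-- The LOG-VOLUME of P♮₁: `−1 − #(deep set)` on bounded regions, `0` elsewhere — monotone, invariant under capsule permutations, and it
separates boxes: a box with MORE deep coordinates is strictly smaller. [folklore] -/
def splitVol (j : splitIndex.Label) (vQ : splitIndex.VQ) (U : Set (splitShells.Packet j vQ)) : ℝ :=
  if U ⊆ box ∅ then -1 - ((deepSet U).card : ℝ) else 0

/-! ## 3. The Θ-datum: theta value in the LAST factor, on the bad summand -/

/-- The factors of the Θ-point: the last factor is `(1 at the bad valuation, 0 at the other)` — the theta value in the sub-packet
`𝓘^ℚ(^{S^±_{j+1},j};−)_v` — the other factors the shallow unit `2`. [claim: Mochizuki2012, status: disputed] -/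
def thetaFn (j : splitIndex.Label) (vQ : splitIndex.VQ) : splitIndex.Caps j → splitShells.Packet1 vQ :=
  fun i v => if i = Fin.last _ then (if v.1 = true then 1 else 0) else 2

/-- **The Θ-point** `thetaPt = ⊗_i thetaFn i` of the packet at label `j`. [claim: Mochizuki2012, status: disputed] -/
def thetaPt (j : splitIndex.Label) (vQ : splitIndex.VQ) : splitShells.Packet j vQ := splitShells.tprod j vQ (thetaFn j vQ)

/-- The Θ-point of the product packet `∏_{j ∈ 𝔽_l^⋇}` at a valuation. [claim: Mochizuki2012, status: disputed] -/
def thetaStar (v : splitIndex.V) : splitShells.StarPacket v := fun j => thetaPt j.1 (splitIndex.over v)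

/-- The Θ-DEEP SET at label `j`: the coordinates not passing through the bad summand of the last factor, `{c | c(j) = false}`.
[folklore] -/
def DTheta (j : splitIndex.Label) : Finset (splitIndex.Caps j → Bool) := Finset.univ.filter fun c => c (Fin.last _) = false

/-! ## 4. Data (a)(b)(c), column, full situation -/

/-- **The data (a)(b)(c) of P♮₁**: integral structure the shallow box, everything admissible, log-volume `splitVol`, splitting monoid the
Θ-point, number field the whole global packet. [claim: Mochizuki2012, status: disputed] -/
def splitData : MRData splitShells where
  shellPk := fun _ _ => box ∅
  shellSub := fun _ _ => box ∅
  Adm := fun _ _ _ => True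
  logvol := fun j vQ A => splitVol j vQ A
  Ψ := fun v _ => {thetaStar v}
  act := fun _ _ _ => 0
  Mmod := fun _ => Set.univ

/-- (c)'s global realified Frobenioids: one object whose region is the shallow box and whose degree is its log-volume.
[claim: Mochizuki2012, status: disputed] -/
def splitDegrees (j : splitIndex.LabelStar) : GlobalDegrees splitShells j where
  ObjMOD := Unit
  Objmod := Unit
  natIso := Equiv.refl Unit
  deg := fun _ => splitVol j.1 () (box ∅)
  region := fun _ _ => box ∅

/-- The SITUATION of P♮₁ (bi-coric strictification: the same data on every vertical line). (An `abbrev`.)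
[claim: Mochizuki2012, status: disputed] -/
abbrev splitSituation : Situation splitIndex where
  L := splitShells
  D := fun _ => splitData
  G := fun _ j => splitDegrees j

/-- The COLUMN of P♮₁: identity Kummer transport at every `(n, m)`. [claim: Mochizuki2012, status: disputed] -/
def splitColumn : Column splitShells where
  frobAdm := fun _ _ _ _ => True
  frobLogvol := fun _ j vQ A => splitVol j vQ A
  frobΨ := fun _ v _ => {thetaStar v}
  frobMmod := fun _ _ => Set.univ
  unitImage := fun _ _ _ _ => box ∅
  ballImage := fun _ _ _ => box ∅
  ObjLGP := ℤ
  frobObjLGP := fun _ => ℤ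
  kumLGP := fun _ => Equiv.refl ℤ
  ObjLgp := ℤ
  frobObjLgp := fun _ => ℤ
  kumLgp := fun _ => Equiv.refl ℤ
  thetaPilot := fun _ => 1

/-- The FULL SITUATION of [IUTchIII] Thm. 3.11 for P♮₁ (link data abc-iut-w5-d247's `naiveLink`). (An `abbrev`.)
[claim: Mochizuki2012, status: disputed] -/
abbrev splitFull : FullSituation splitIndex where
  toSituation := splitSituation
  col := fun _ => splitColumn
  link := naiveLink

/-! ## 5. The setting: honest pilot objects over the split index, glue reading the object -/

/-- Output of [IUTchIII] Prop. 3.7 for P♮₁ (abc-iut-w4-d101's `pinSig` transcribed to the split index: objects are exponents `k : ℤ`, the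
object-forming algorithm reads the exponent of the monoid element at the bad valuation `true`). [claim: Mochizuki2012, status: disputed] -/
def splitSig : GlobalLGPFrobenioidSignature 2 Bool (· ∈ ({true} : Set Bool)) Unit (fun _ _ => Unit)
    (fun _ => ℤ) id Unit (fun _ _ => Unit) (fun _ _ => ExpMonoid) where
  FMOD := fun _ => ()
  Fmod := fun _ => ()
  Ffrak := fun _ => ()
  isoModMOD := fun _ => ()
  isoModFrak := fun _ => ()
  isoFrakMOD := fun _ => ()
  CLGP := ()
  Clgp := ()
  FLGP := ()
  Flgp := ()
  Fgau := ()
  isoGauLGP := ()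
  isoLGPlgp := ()
  isoCLGPlgp := ()
  embLGP := fun k _ => k
  embLgp := fun k _ => k
  embLGP_injective := fun a b h => by simpa using congrFun h 0
  embLgp_injective := fun a b h => by simpa using congrFun h 0
  objOfLgp := fun x => (expOf (x true rfl) : ℤ)
  objOfLGP := fun x => (expOf (x true rfl) : ℤ)
  objOfFrak := fun x _ => (expOf (x true rfl) : ℤ)
  objOfMOD := fun x _ => (expOf (x true rfl) : ℤ)

/-- The Θ-glue reading the object: the lgp-object of exponent `k` at label `j ∈ 𝔽_l^⋇` is the box deep to depth `2 − k` on the Θ-deep set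
(depth `1` = a hull-set for the pilot, `k = 1`); the shallow box at the zero label. [claim: Mochizuki2012, status: disputed] -/
def thetaRegionSplit (k : ℤ) (j : splitIndex.Label) (vQ : splitIndex.VQ) : Set (splitShells.Packet j vQ) :=
  if j = 0 then box ∅ else boxLE (2 - (k : ℚ)) (DTheta j)

/-- The q-glue reading the object: the `△`-object of exponent `k` at label `j ∈ 𝔽_l^⋇` is the box deep to depth `2 − k` on the SWAPPED
deep set `permD (swapLast j) (DTheta j)` = `{c | c(0) = false}`; the shallow box at the zero label. [claim: Mochizuki2012, status: disputed] -/
def qRegionSplit (k : ℤ) (j : splitIndex.Label) (vQ : splitIndex.VQ) : Set (splitShells.Packet j vQ) :=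
  if j = 0 then box ∅ else boxLE (2 - (k : ℚ)) (permD (swapLast j) (DTheta j))

/-- At exponent `1` the Θ-glue is the hull-set `box (DTheta j)` on `𝔽_l^⋇`. [folklore] -/
theorem thetaRegionSplit_one_of_ne_zero {j : splitIndex.Label} (hj : j ≠ 0) (vQ : splitIndex.VQ) :
    thetaRegionSplit 1 j vQ = box (DTheta j) := by
  unfold thetaRegionSplit; rw [if_neg hj]; norm_num; rfl

/-- At exponent `1` the q-glue is the hull-set `box (permD (swapLast j) (DTheta j))` on `𝔽_l^⋇`. [folklore] -/
theorem qRegionSplit_one_of_ne_zero {j : splitIndex.Label} (hj : j ≠ 0) (vQ : splitIndex.VQ) :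
    qRegionSplit 1 j vQ = box (permD (swapLast j) (DTheta j)) := by
  unfold qRegionSplit; rw [if_neg hj]; norm_num; rfl

/-- At the zero label both glues are the shallow box. [folklore] -/
theorem regionSplit_zero (k : ℤ) (vQ : splitIndex.VQ) : thetaRegionSplit k 0 vQ = box ∅ ∧ qRegionSplit k 0 vQ = box ∅ :=
  ⟨if_pos rfl, if_pos rfl⟩

/-- `qRegionSplit 1` is a hull-set at every label. [folklore] -/
theorem qRegionSplit_one_mem (j : splitIndex.Label) (vQ : splitIndex.VQ) : qRegionSplit 1 j vQ ∈ splitHul j vQ := by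
  by_cases hj : j = 0
  · subst hj; rw [(regionSplit_zero 1 vQ).2]; exact ⟨∅, rfl⟩
  · rw [qRegionSplit_one_of_ne_zero hj]; exact ⟨_, rfl⟩

/-- **The setting P♮₁ of Cor. 3.12** over `splitSituation` (column `n = 0`): honest object side (`ExpMonoid`, `splitSig`, pilots of exponent
`1`), hull frame `splitFrame`, glue reading the object. [claim: Mochizuki2012, status: disputed] -/
def splitSetting : Setting splitSituation where
  n := 0
  HT := ℤ × ℤ
  LogLink := fun _ _ => Unit
  IsFull := fun _ => True
  lattice :=
    { theater := fun n m => (n, m)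
      distinct := fun p q h => by simpa using h
      logLink := fun _ _ => ()
      logLink_full := fun _ _ => trivial }
  Frd := Unit
  IsoF := fun _ _ => Unit
  Ob := fun _ => ℤ
  realify := id
  Strip := Unit
  IsoS := fun _ _ => Unit
  M := fun _ _ => ExpMonoid
  sig := splitSig
  split := { Msplit := fun _ _ => ⊤, exists_gen := fun _ _ => ⟨⟨gen, trivial⟩, top_gen_isGenerator⟩ }
  ObΔ := ℤ
  N := fun _ _ => ExpMonoid
  qData :=
    { q := fun _ _ => gen
      q_gen := fun _ _ => gen_isGenerator
      objOf := fun x => (expOf (x true rfl) : ℤ) }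
  frame := fun j vQ => splitFrame j vQ
  hul_adm := fun _ _ _ _ => trivial
  thetaRegionOf := fun _ k j vQ => thetaRegionSplit k j vQ
  qRegionOf := fun k j vQ => qRegionSplit k j vQ
  qRegion_mem := fun j vQ => qRegionSplit_one_mem j vQ
  qSupport_finite := fun _ => Set.toFinite _

/-! ## 6. The region operator and the q-pilot Kummer datum -/

open scoped Classical in
/-- The box generated by a point: deep exactly where the point's coordinate is `≤ 1` in absolute value. [folklore] -/
def pointBox {j : splitIndex.Label} {vQ : splitIndex.VQ} (y : splitShells.Packet j vQ) : Set (splitShells.Packet j vQ) :=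
  box (Finset.univ.filter fun c => |coord j vQ c y| ≤ 1)

/-- **The region operator `ρ` of P♮₁**: at a label `j ∈ 𝔽_l^⋇`, the union over the points `ψ` of the datum at the bad valuation of the boxes
generated by their `j`-components; the shallow box at the zero label. Defined through the coordinates only, hence equivariant under every
family acting by capsule permutations — in particular under ⟨(Ind1)∪(Ind2)⟩. [claim: Mochizuki2012, status: disputed] -/
def boxRegion (Ψ : ∀ v : splitIndex.V, v ∈ splitIndex.Vbad → Set (splitShells.StarPacket v)) (j : splitIndex.Label)
    (vQ : splitIndex.VQ) : Set (splitShells.Packet j vQ) :=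
  if h : j = 0 then box ∅ else ⋃ ψ ∈ Ψ true rfl, pointBox (ψ ⟨j, h⟩)

/-- **The q-pilot's Kummer datum in P♮₁**: the translate of the Θ-datum by the (Ind1)-family `swapFamily` (abc-iut-w5-d155's (L) with
(LI) `Φ₀ = swapFamily ∈ (Ind1)`). [claim: Mochizuki2012, status: disputed] -/
def qDatumSplit : ∀ v : splitIndex.V, v ∈ splitIndex.Vbad → Set (splitShells.StarPacket v) :=
  fun v _ => splitShells.starAut swapFamily v '' {thetaStar v}

end SplitWitness

end Summit.ABC.IUTFork.Cor312Vol

end
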